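import Literature.IUT.HodgeTheaters.PolyIsoFunctoriality
import Literature.IUT.HodgeArakelov.RealifiedPrimeStripSplitCategories

/-!
# [IUTchII] Cor 4.10 (iv) at print level: `F^{⊩▶×μ} ↦ F^{⊢×μ}` is surjective on automorphisms and on isomorphisms
# (the GAP-LEDGER row G-w4d028-1 residual, for the print-level strip groupoids)

Proof-only file, 0 defs (abc-iut cell, wave-4 seat abc-iut-w4-d028; over abc-iut-L6-t2's print-level strip groupoids
`LocalTriMuDataSplitIso` / `KummerPrimeStripSplitCategories` / `RealifiedPrimeStripSplitCategories`, imported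
unchanged). S. Mochizuki, *Inter-universal Teichmüller theory II*, kurims Dec-2020 manuscript, Def 4.9 (iii) p.155,
(iv) p.156, (vii)–(viii) p.158, Cor 4.10 (iv) p.160 [cite: Mochizuki2012, Cor 4.10 (iv) p.160]; *III*, kurims
May-2020 manuscript, Thm 1.5 (ii) p.48, Thm 2.2 (i) p.65. Claim key DISPUTED (D-0012): nothing here asserts a
disputed claim or takes a side on [IUTchIII] Cor 3.12.

**The residual.** The Cor 3.12 cone consumes ONE frame-level property of the functor `F^{⊩▶×μ} ↦ F^{⊢×μ}`
([IUTchII] Def 4.9 (vi)–(viii)) in three typings — `HodgeTheaterStrips.UnitMuCoric` (Cor 4.10 (iv), FACT-LIST F-2065),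
`ThetaLinkData.induced_full` ([IUTchIII] Thm 1.5 (ii)), `ThetaMonoidData.mapAut_surjective` ([IUTchIII] Thm 2.2 (i)
"the second arrows in each line are surjections", p.65) —, shown equivalent to `R :≡ (full).map (F^{⊩▶×μ} ↦ F^{⊢×μ}) = full`
⇔ `Aut`-surjectivity in `LogThetaLattice/UnitMuCoricFrame` (abc-iut-w4-d028) and NOT formal for the `O^▷`-level
morphisms (`LocalTriMuDataIsoSurjectivityWitness`, GAP-LEDGER G-w4d028-1). For the PRINT-level morphisms — local
data `O^{▶×μ} = O^▶ × O^{×μ}` (Def 4.9 (iii)/(iv)), strip morphisms = "an isomorphism between collections of data as discussed above"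
(Def 4.9 (viii) p.158) as typed by abc-iut-L6-t2's `FVdashSplitTriMuPrimeStrip` — this file PROVES it:

* `LocalTriMuDatum.SplitIso.exists_ofMu` — every `×μ`-automorphism of a local datum is the `×μ`-component of a split
  automorphism with IDENTITY `O^▶`-component (by type of place);
* `FVdashSplitTriMuPrimeStrip.exists_liftMu` — every family of `×μ`-automorphisms is the image, under passing to
  `F^{⊢×μ}` (`toSplitStripFunctor ⋙ FSplitTriMuPrimeStrip.toTimesMuFunctor`, the `StripFrame.FglxmToFxm` shape), of an
  automorphism of the `F^{⊩▶×μ}`-prime-strip that is the identity on the global realified Frobenioid data and on every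
  `O^▶_v` (hence compatible with `ρ_v` and the generators at bad places for free);
* **`mapAut_toTimesMu_surjective`** — `Aut_{F^{⊩▶×μ}}(S) ↠ Aut_{F^{⊢×μ}}(S)` ([IUTchIII] Thm 2.2 (i) shape), for EVERY
  strip, no hypothesis;
* **`mapIso_toTimesMu_surjective_of_model`** / **`map_full_toTimesMu_of_model`** — with the kit rule (paraphrase of Def 4.9
  (vii)/(viii): every `F^{⊩▶×μ}`-prime-strip is isomorphic to the model): `Isom_{F^{⊩▶×μ}}(S,T) ↠ Isom_{F^{⊢×μ}}(S,T)`, i.e.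
  the functor carries the full poly-isomorphism onto the full poly-isomorphism — [IUTchII] Cor 4.10 (iv) "one
  obtains a poly-isomorphism `†F^{⊢×μ}_△ ⥲ ‡F^{⊢×μ}_△` which coincides with the full poly-isomorphism", formal at print
  level (p.160: "The definition of the unit portion of the theta and Gaussian monoids involved […] gives rise to
  natural isomorphisms").
So for a strip frame whose `Fglxm`/`Fvtxm`/`Fxm`, `FglxmToFvtxm`/`FvtxmToFxm` are these groupoids/functors
(abc-iut-L6-t3's `StripFrame.ofKits`, B10 part 2) the residual `R` holds, and the three interface fields above are
dischargeable there. Typed ≠ discharged elsewhere.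
-/

namespace Literature.IUT.HodgeArakelov

open CategoryTheory
open Literature.IUT.HodgeTheaters (PolyIso)

universe u v w

/-! ### 1. Local data: split automorphisms with identity value part -/

namespace LocalTriMuDatum

variable {l : ℕ} {G : Type u} [Group G] {X : GroupTheoreticUnits.{u, w} G}

/-- **IUTchII:Def4.9(vii)** (kurims p.158) every `×μ`-automorphism `m` of a local `F^{⊢▶×μ}`-datum is the
`×μ`-component of a split AUTOMORPHISM whose `O^▶`-component is the IDENTITY — possible exactly because the
printed monoid is the direct product `O^{▶×μ} = O^▶ × O^{×μ}` (Def 4.9 (iii)/(iv)); by type of place.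
[cite: Mochizuki2012, Def 4.9 (vii) p.158] -/
theorem SplitIso.exists_ofMu : ∀ {k : PlaceKind} {D : LocalTriMuDatum.{u, v, w} l G X k} (m : MuIso D D),
    ∃ s : SplitIso D D, s.eTri = MulEquiv.refl _ ∧ s.toMuIso = m
  | _, .bad D, m => ⟨(⟨MulEquiv.refl _, fun _ _ => rfl, m⟩ : NonarchTriMuDatum.SplitIso D D), rfl, rfl⟩
  | _, .good D, m => ⟨(⟨MulEquiv.refl _, fun _ _ => rfl, m⟩ : NonarchTriMuDatum.SplitIso D D), rfl, rfl⟩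
  | _, .arch D, m => ⟨(⟨⟨MulEquiv.refl _, m.down⟩⟩ : ULift.{max u w} (ArchTriMuDatum.SplitIso D D)), rfl, rfl⟩

end LocalTriMuDatum

/-! ### 2. `F^{⊩▶×μ}`-prime-strips: lifting `×μ`-automorphisms -/

namespace FVdashSplitTriMuPrimeStrip

variable {V : Type u} {P : PlaceData V} {G : V → Type u} [∀ v, Group (G v)]
  {X : ∀ v, GroupTheoreticUnits.{u, w} (G v)}

/-- **IUTchII:Def4.9(viii)** (kurims p.158) THE LIFT: every `V`-family `m` of `×μ`-automorphisms of the local data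
of an `F^{⊩▶×μ}`-prime-strip `S` is the image under passing to `F^{⊢×μ}` (`F^{⊩▶×μ} ↦ F^{⊢▶×μ} ↦ F^{⊢×μ}`, the
`StripFrame.FglxmToFxm` shape) of an automorphism of `S` — namely the one that is the identity on the realified global
Frobenioid data (classes, degrees, pilot class) and on every `O^▶_v` (so compatible with the valuations `ρ_v` and the
generators at bad places for free), with `×μ`-components `m v`. [cite: Mochizuki2012, Def 4.9 (viii) p.158] -/
theorem exists_liftMu (S : FVdashSplitTriMuPrimeStrip.{u, v, w} P G X)
    (m : ∀ v : V, LocalTriMuDatum.MuIso (S.data.strip.localDatum v) (S.data.strip.localDatum v)) :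
    ∃ f : S ⟶ S, (toSplitStripFunctor ⋙ FSplitTriMuPrimeStrip.toTimesMuFunctor).map f = m := by
  choose s hs_tri hs_mu using fun v => LocalTriMuDatum.SplitIso.exists_ofMu (m v)
  refine ⟨({ classEquiv := Equiv.refl _
             degClass_eq := fun _ => rfl
             map_pilotClass := rfl
             locSplitIso := s
             map_rho := fun v a => by rw [hs_tri, MulEquiv.refl_apply]
             map_triGen := fun v h => by rw [hs_tri, MulEquiv.refl_apply] } : Hom S S), ?_⟩
  funext v
  exact hs_mu v

/-- **IUTchII:Cor4.10(iv)** (kurims p.160) / [IUTchIII] Thm 2.2 (i) p.65 "the second arrows in each line are surjections", AT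
PRINT LEVEL, PROVED: for every `F^{⊩▶×μ}`-prime-strip `S`, `Aut_{F^{⊩▶×μ}}(S) → Aut_{F^{⊢×μ}}(S)` (passing to `F^{⊢×μ}`) is
SURJECTIVE — every `×μ`-automorphism lifts by the identity on the value-group and global realified data.
[cite: Mochizuki2012, Cor 4.10 (iv) p.160] -/
theorem mapAut_toTimesMu_surjective (S : FVdashSplitTriMuPrimeStrip.{u, v, w} P G X) :
    Function.Surjective ((toSplitStripFunctor ⋙ FSplitTriMuPrimeStrip.toTimesMuFunctor).mapAut S) := by
  intro φ
  obtain ⟨f, hf⟩ := exists_liftMu S φ.hom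
  refine ⟨(Groupoid.isoEquivHom S S).symm f, ?_⟩
  ext
  exact hf

/-- **IUTchII:Cor4.10(iv)** (kurims p.160) hence, for every `F^{⊩▶×μ}`-prime-strip isomorphic to `S`, EVERY
`F^{⊢×μ}`-isomorphism between the images is the image of an `F^{⊩▶×μ}`-isomorphism: surjectivity on `Isom(S, T)` from one
isomorphism `S ≅ T` (lift `φ ≫ (image e)⁻¹ ∈ Aut` and compose with `e`). [cite: Mochizuki2012, Cor 4.10 (iv) p.160] -/
theorem mapIso_toTimesMu_surjective_of_iso {S T : FVdashSplitTriMuPrimeStrip.{u, v, w} P G X} (e : S ≅ T) :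
    Function.Surjective
      ((toSplitStripFunctor ⋙ FSplitTriMuPrimeStrip.toTimesMuFunctor).mapIso :
        (S ≅ T) → ((toSplitStripFunctor ⋙ FSplitTriMuPrimeStrip.toTimesMuFunctor).obj S ≅
          (toSplitStripFunctor ⋙ FSplitTriMuPrimeStrip.toTimesMuFunctor).obj T)) := by
  intro φ
  obtain ⟨a, ha⟩ := mapAut_toTimesMu_surjective S
    (φ ≪≫ ((toSplitStripFunctor ⋙ FSplitTriMuPrimeStrip.toTimesMuFunctor).mapIso e).symm)
  refine ⟨a ≪≫ e, ?_⟩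
  have ha' : (toSplitStripFunctor ⋙ FSplitTriMuPrimeStrip.toTimesMuFunctor).mapIso a =
      φ ≪≫ ((toSplitStripFunctor ⋙ FSplitTriMuPrimeStrip.toTimesMuFunctor).mapIso e).symm := ha
  rw [Functor.mapIso_trans, ha', Iso.trans_assoc, Iso.symm_self_id, Iso.trans_refl]

/-- **IUTchII:Cor4.10(iv)** (kurims p.160) with the KIT RULE (paraphrase of Def 4.9 (vii)/(viii) p.158: every
`F^{⊩▶×μ}`-prime-strip is isomorphic to a model strip `M`): passing to `F^{⊢×μ}` is surjective on
`Isom(S, T)` for ALL `S`, `T`. [cite: Mochizuki2012, Cor 4.10 (iv) p.160] -/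
theorem mapIso_toTimesMu_surjective_of_model (M : FVdashSplitTriMuPrimeStrip.{u, v, w} P G X)
    (hM : ∀ S : FVdashSplitTriMuPrimeStrip.{u, v, w} P G X, Nonempty (S ≅ M))
    (S T : FVdashSplitTriMuPrimeStrip.{u, v, w} P G X) :
    Function.Surjective
      ((toSplitStripFunctor ⋙ FSplitTriMuPrimeStrip.toTimesMuFunctor).mapIso :
        (S ≅ T) → ((toSplitStripFunctor ⋙ FSplitTriMuPrimeStrip.toTimesMuFunctor).obj S ≅
          (toSplitStripFunctor ⋙ FSplitTriMuPrimeStrip.toTimesMuFunctor).obj T)) :=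
  mapIso_toTimesMu_surjective_of_iso (iso_nonempty_of_model M hM S T).some

/-- **IUTchII:Cor4.10(iv)** (kurims p.160) "one obtains a poly-isomorphism `†F^{⊢×μ}_△ ⥲ ‡F^{⊢×μ}_△` which coincides
with the full poly-isomorphism between these two `F^{⊢×μ}`-prime-strips" — at print level, with the kit rule, PROVED in the tree's `PolyIso` vocabulary
([IUTchI] §0): the image of the full poly-isomorphism of `F^{⊩▶×μ}`-prime-strips under passing to `F^{⊢×μ}` IS the
full poly-isomorphism of `F^{⊢×μ}`-prime-strips. This is the frame-level residual `R` of
`LogThetaLattice/UnitMuCoricFrame` (⇒ `UnitMuCoric`, `ThetaLinkData.induced_full`, `ThetaMonoidData.mapAut_surjective`)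
for any strip frame built on these groupoids. [cite: Mochizuki2012, Cor 4.10 (iv) p.160] -/
theorem map_full_toTimesMu_of_model (M : FVdashSplitTriMuPrimeStrip.{u, v, w} P G X)
    (hM : ∀ S : FVdashSplitTriMuPrimeStrip.{u, v, w} P G X, Nonempty (S ≅ M))
    (S T : FVdashSplitTriMuPrimeStrip.{u, v, w} P G X) :
    (PolyIso.full S T).map (toSplitStripFunctor ⋙ FSplitTriMuPrimeStrip.toTimesMuFunctor) = PolyIso.full _ _ := by
  ext φ
  simp only [PolyIso.mem_map, PolyIso.mem_full, true_and, iff_true]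
  exact mapIso_toTimesMu_surjective_of_model M hM S T φ

end FVdashSplitTriMuPrimeStrip

end Literature.IUT.HodgeArakelov
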